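import Literature.MathematicalPhysics.QuantumFieldTheory.Balaban1983to89.B8Eq12HodgeLaplacianV1
import Literature.MathematicalPhysics.QuantumFieldTheory.Balaban1983to89.B8Eq17ClassAkV1
import Literature.MathematicalPhysics.QuantumFieldTheory.Balaban1983to89.T4CubeChartCircle
import Literature.MathematicalPhysics.QuantumFieldTheory.Balaban1983to89.B8Ineq159MultiLevelTorus

/-!
# `Balaban1983to89.B8Eq155AbelianMultiLevelTorus` — T. Bałaban, *Spaces of regular gauge field configurations on a lattice and gauge fixing
# conditions*, Commun. Math. Phys. **99** (1985) 75–102 [Balaban1985RegularSpaces], **(1.55)** p. 86 «|J|₍₋₃₎ ≦ 2α₀ + 36dα₂|∇^η_{U₀}A|₍₋₂₎ + 50dα₂³ +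
# 10dα₀α₂» DERIVED — not assumed — AT THE FLAT BACKGROUND `U₀ = 1` FOR THE ABELIAN GROUP `U(1)` (`U₁ = e^{iηA}`, `A` a REAL bond function) ON THE
# `k`-LEVEL V1 TORUS, FROM THE PRINTED HYPOTHESES (1.40) (its (1.9) member for `U₁`) AND (1.41), following pp. 84–86 ((1.47) third-order expansion of
# the plaquette variable, (1.49)–(1.50) with the commutator brace ≡ 0, (1.2) at `U₁` = the flat `∂*`, (1.54) ⇒ (1.55))

statement-level skeleton of published theorems with citation tags; proofs where landed; nothing here is a claim about the Yang–Mills mass gap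

PDF held: `paper:balaban1985-cmp99-regular-spaces-gauge-fixing` (journal page = PDF page + 74); pp. 76–77, 83–86 [PDF 2–3, 9–12] re-read this
generation AS IMAGES on the ×2 renders `run/shared/lean/pub/pub-balaban/b2b-balaban-ref1/pages/1985-cmp99-regular-spaces-gauge-fixing/…-p002/p003/
p005/p009/p010/p011/p012-x2.png` and on the text layer (`lit read … --pages 9-14`, p0009–p0013.txt).  STATUS: published, refereed.

CITATION HEADER (lean-in-tree rule).  Cell `lit-balaban` (HOME `run/shared/lean/pub/lit-balaban/`), unit `lit-balaban-r05` gen 70 (B8 reader/typer and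
fold owner; free target under protocol G.5-34(d), TAKING HOME/STATUS.md 2026-08-23T20:23:00Z, window honoured, FYI lines to p40 (author of the typed (1.9)
`B8Eq17ClassAkV1.BondClause19`) and lead; the successor step (iii)(b) «the B8-SIDE instances (1.55)/(1.42)/(1.56) at U₀ = 1 for a concrete Landau-gauge
U′ = e^{iηA}» of HOME/lit-balaban-r05/HANDOFF.md § gen 69 FINAL).  WHAT IS REPRODUCED = SKELETON rows **B8.Eq1.55** ((1.55)), **B8.Eq1.54** ((1.54)),
**B8.Eq1.43** ((1.47)–(1.48)), **B8.Eq1.40** ((1.40)–(1.41)) and **B8.Prop3** — CELLS ONLY, heads do not move (the non-abelian statements at an arbitrary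
regular `U₀` are PROVED on the ℤᵈ lineage carriers: `B8Eq143PlaqExpansion`, `B8Eq146AExpansion`, `B8Eq151V2Divergence`, `B8Eq155JBound` (b08) with the printed
LOCAL «on Ω_j» forms `B8Eq148Local`, `B8Eq154Local` (p40); this file is the «kernel-checked proof of a MODEL INSTANCE» on the carriers of the `U₀ = 1`
multi-level torus lane — p21's torus family `TDomains` with r03's V1 chart `B6GlobalChartV1` — whose real scalar fibre IS the Lie algebra of `U(1)`).

WHY, AND WHY NOW.  `B8Prop3MultiLevelTorusP26.prop3_multiLevelTorus_V1_P26_vector` (own, v1.5, p368650 ✓ 5c1baa6b1e1c) is PROPOSITION 3 at `U₀ = 1` on the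
`k`-level V1 torus with NO [B6]-side hypothesis, modulo the B8-side hypotheses ONLY: (1.55) «D^{η*}_{U₀}D^η_{U₀}A = J, |J|₍₋₃₎ ≦ 2α₀ + 36dα₂|∇A|₍₋₂₎ + 50dα₂³ +
10dα₀α₂» taken as a SIZE LINE on a free source `J`, the Landau clause of (1.42), the linear average `QA = B` with the (1.56) size line, the smallness lines and
(1.61).  In print (1.55) is not a hypothesis: it is DERIVED (pp. 83–86) from (1.40) `U₀, U₁U₀ ∈ 𝔄_k({Ω_j}, α₀)` and (1.41) `U₁ = e^{iηA}, |A| < α₂(Lʲη)⁻¹` through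
the non-linear relation between `U₁` and `J = D^{η*}_{U₀}D^η_{U₀}A` — the basic estimate (1.54).  On this lane's carriers the field `A` is a REAL bond function;
the gauge group whose Lie algebra that is, is `U(1)`, and for `U(1)` the whole of pp. 84–86 collapses to three lines, which this file kernel-checks; the
consumer is `B8Prop3MultiLevelTorusP26` v1.6 `prop3_multiLevelTorus_V1_P26_U1` (filed after this file lands): Proposition 3 at `U₀ = 1` for `U(1)` fields FROM
(1.40)/(1.41)/(1.42) — the first of the three B8-side hypotheses removed.

WHAT IS PRINTED (verbatim, pages re-read).  p. 76 [PDF 2]: *"(D^η_{U,μ}F)(x) = η⁻¹(R(U(x, x + ηe_μ))F(x + ηe_μ) − F(x)), (D^{η*}_{U,μ}F)(x) = η⁻¹(R(U(x,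
x − ηe_μ))F(x − ηe_μ) − F(x)), (1.1) where U is an arbitrary gauge field configuration, and R(U)X = UXU⁻¹ … (D^{η*}_U F)(x, x + ηe_μ) = (D^{η*}_U F)_μ(x) =
Σ_{ν<μ}(D^{η*}_{U,ν}F_{νμ})(x) − Σ_{ν>μ}(D^{η*}_{U,ν}F_{μν})(x). (1.2)"*.  p. 77 [PDF 3]: *"|U(∂p) − 1| < α₀η²(Lʲη)⁻² for p ⊂ Ω_j, (1.8)  |(D^{η*}_U ∂U)(b)| <
α₀L^{−2j}(Lʲη)⁻¹ for b ∈ Ω_j, j = 0, 1, …, k. (1.9)"*.  p. 83 [PDF 9]: *"We assume that we have configurations U₀, U₁U₀ satisfying the following conditions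
U₀, U₁U₀ ∈ 𝔄_k({Ω_j}, α₀), U₀ satisfies the additional regularity condition (3.35) in [4], (1.40)  U₁ = e^{iηA}, |A| < α₂(Lʲη)⁻¹ on Ω_j, (1.41)  R(U₀)D^{η*}_{U₀}A
= 0, Q_j(U₀, ηA) = B on Λ_j, |B| < 2dLα₁, (1.42)"*.  p. 84 [PDF 10]: *"Because ∂_{U₀}U₁ − 1 = O₁(4α₂(Lʲη)⁻¹η) … (∂_{U₀}U₁)(p) − 1 = iη²(D^η_{U₀}A)(p) −
½η²V₂(U₀, A, ∂p) + O₁((1/3!)η³(∂|A|(p))³), (1.47) where V₂ is a polynomial of the second order in A. Thus D^{η*}_{U₀}(∂_{U₀}U₁ − 1) = iη²D^{η*}_{U₀}D^η_{U₀}A −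
½η²D^{η*}_{U₀}V₂(U₀, A) + O₁((4³/3)dα₂³(Lʲη)⁻³η²). (1.48)"*.  p. 85 [PDF 11]: *"V₂(U₀, A, ∂p) = … = η²((D^η_{U₀}A)(p))² + {[A(x, y), R(U₀(x, y))A(y, z)] + …}
(1.49) This equality holds for arbitrary A in the complexified Lie algebra, but if A is Hermitian, then the first expression above is a real part of V₂, and
the second is an imaginary part of V₂, multiplied by i. … D^{η*}_{U₁U₀}∂U₁U₀ = D^{η*}_{U₀}∂U₀ + iη²D^{η*}_{U₀}D^η_{U₀}A + O₁(36dα₂(Lʲη)⁻¹|∇^η_{U₀}A|η²) +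
O₁(50dα₂³(Lʲη)⁻³η²) + O₁(10dα₀α₂(Lʲη)⁻³η²) on Ω_j. (1.54)"*.  p. 86 [PDF 12]: *"We will apply it to get regularity results for A, assuming (1.40)–(1.42). From
(1.40) the term on the left-hand side and the first term on the right-hand side can be estimated by α₀(Lʲη)⁻³η². This implies that D^{η*}_{U₀}D^η_{U₀}A = J,
|J| ≦ (2α₀ + 36dα₂(Lʲη)²|∇^η_{U₀}A| + 50dα₂³ + 10dα₀α₂)(Lʲη)⁻³, (1.55) or |J|₍₋₃₎ ≦ 2α₀ + 36dα₂|∇^η_{U₀}A|₍₋₂₎ + 50dα₂³ + 10dα₀α₂, where the norms |·|₍α₎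
were introduced in [4]. For the reader's convenience let us recall the definition: |A|₍α₎ = sup_j sup_{Ω_j} (Lʲη)^{−α}|A|."*

THE ROUTE, AND WHERE IT DEVIATES FROM PRINT (CONVENTIONS: «deviate only where the tree already provides a step or a genuinely shorter road; say which»).
Print's chain at a general `U₀`: (1.43)–(1.44) (cross terms with `U₀(∂p) − 1`, the `10dα₀α₂` term), (1.45)–(1.46) (the `D^{η*}_{U₁U₀} − D^{η*}_{U₀}`
correction, `28dα₂³`), (1.47)–(1.48) (third-order expansion of `∂_{U₀}U₁`, `(4³/3)dα₂³`), (1.49)–(1.53) (`½η²D^{η*}V₂ = O₁(32dα₂(Lʲη)⁻¹|∇A|η²)` through the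
commutators (1.50)–(1.52)), (1.54), then (1.55) by (1.9) for `U₁U₀` and for `U₀`.  HERE `U₀ = 1` and the group is `U(1)`: `U₀(∂p) − 1 = 0` (no (1.43)–(1.44)
terms), `R ≡ id` so `D^{η*}_{U₁U₀} = D^{η*}_{U₀} = ∂*` exactly (no (1.45)–(1.46) terms; §2), the plaquette variable is `U₁(∂p) = e^{iθ(p)}` with the REAL phase
`θ(p) = η·(∂₁A)(p) = η²(D^ηA)(p)` (§1), the commutator brace of (1.49)–(1.50) vanishes so `V₂ = η²(D^ηA)² = θ²` is REAL (p. 85's own remark), and (1.47)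
is the Taylor expansion of `e^{iθ}`.  Consequently `D^{η*}_{U₁}∂U₁ = ∂*(e^{iθ} − 1)` has IMAGINARY part `∂*(sin θ) = ∂*θ − ∂*(θ − sin θ)` with `∂*θ = η²J`
EXACTLY, and REAL part `∂*(cos θ − 1) = −½∂*(θ²) + …` carrying the whole (1.49)–(1.53) contribution: the `36dα₂|∇A|η²`-term of (1.54) does not enter the
bound for `J` (a genuinely shorter road available for the abelian group only; print needs the norm because the commutators of (1.50) are anti-Hermitian).
The third-order remainder is handled as in (1.47)–(1.48): `|sin θ − θ| ≤ |θ|³/5` for `|θ| ≤ 1` (Mathlib's `Real.sin_bound`; print's `1/3!` for the full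
exponential series) through the `2(d−1)` plaquettes of a bond and one factor `η⁻¹`.  Result: `|J|₍₋₃₎ ≦ α₀ + c·α₂³` with `c = (128/5)(d−1)` in the local
reading — inside print's `2α₀ + … + 50dα₂³ + …` — and `c = (128/5)·d·L³` on the `k`-level torus of dimension `d + 1` in the GLOBAL `blkV1` level encoding of
`B8Prop3MultiLevelTorusP26` (the sides of the plaquettes through a bond of level `j` have levels `≥ j − 1`, §4.1: the located one-layer-wider reading of «on
Ω_j», cell GAPS G-B8-16 — print reads (1.41) on them at level `j`).  Print's (1.55) follows verbatim with `d` read as any real `d_P ≥ d·L³` (§4.3).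

WHAT THIS FILE PROVES (0 sorry, 0 `def … : Prop`; three small definitions with bodies — `adU1` (the trivial adjoint action of `U(1)` read on
`ℂ`), `entryU1` (`ι : U(1) ⊂ ℂ`), `expCfg` (`U₁ = e^{iηA}`) —, theorems otherwise; axioms standard).
* §1 THE `U(1)` DICTIONARY on the cell's `U(1)` (`T4CubeChartCircle.U1 = Matrix.unitaryGroup (Fin 1) ℂ`, `expU θ = e^{iθ}`): `conj_eq_self_U1` (`UXU⁻¹ = X`),
  `entryU1_expU`, `norm_entryU1`, `expU_add`/`expU_neg`, **`plaqHol_expCfg`** (`U₁(∂p) = e^{iη(∂₁A)(p)}` — the abelian (1.21)/(1.47)), `entryU1_plaqHol_expCfg`.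
* §2 (1.1)–(1.2) FOR `U(1)`: `covDAdj_adU1` (`D^{η*}_{U,ν} = ∂*_ν` for every `U`), `covDivPlaq_adU1` / `covDivPlaq_adU1_eq_one` ((1.2) is the flat divergence),
  **`im_covDivPlaq_adU1`** (`Im(D^{η*}_U F) = dcsE c (Im F)` — the `ℓ²`-adjoint of the curl, by `B8Eq12HodgeLaplacianV1.dcsE_apply`), `covDivPlaq_adU1_ofReal`,
  **`abs_dcsE_apply_le`** (`|(∂*g)(b)| ≤ |c|·2(d−1)·M` if `|g| ≤ M` on the `2(d−1)` plaquettes through `b`; p. 84's passage «4α₂α₀(Lʲη)⁻³η³ … 8dα₂α₀(Lʲη)⁻³η²»).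
* §3 AT ONE BOND (any torus `Site P 0`, any `η > 0`): `abs_sin_sub_self_le` ((1.47)'s remainder for the phase), `dcE_eq_smul_one`, `dcsE_apply_eq_mul_one`,
  `hodge_apply_eq_sq_mul` (`∂*_c∂_c = c²∂*₁∂₁`), **`abs_hodge_le_loc`** — (1.54) ⇒ (1.55) LOCALLY: `|(∂*₁∂₁A)(b)| ≤ |(D^{η*}_{U₁}∂U₁)(b)| + η⁻¹·2(d−1)·t³/5`
  whenever `|θ| ≤ t ≤ 1` on the plaquettes through `b` (the (1.9) quantity EXACTLY as in p40's `BondClause19`: `covDivPlaq adU1 η⁻¹ U₁ (entryU1 ∘ U₁(∂·))`),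
  `norm_entryU1_plaqHol_sub_one_le` ((1.41) ⇒ (1.8): `|U₁(∂p) − 1| ≤ |θ(p)|`, p. 84 «∂_{U₀}U₁ − 1 = O₁(4α₂(Lʲη)⁻¹η)»), `abs_curl_one_le` (`|∂₁A(p)| ≤ Σ|A(sides)|`).
* §4 ON THE `k`-LEVEL V1 TORUS (`PV d ℓ m K hd hL`, `TDomains d ℓ M_h k P′ R`, `hN`, levels `(geomT D).len (blkV1 hN D b) = L^{j(b)}`, `j(b) = lev(b₋)`):
  §4.1 `torusSupNorm_le_one_of_near`, **`lev_le_lev_add_one_of_near`** (neighbouring sites have neighbouring levels, from (2.2)/(1.4) `TDomains.sepT`, `R ≥ 1`,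
  `M_h ≥ 1`), `near_refl`/`near_shift`/`near_of_shift_eq`/`near_shift_of_shift_eq`; §4.2 **`abs_hodge_one_le_kLevel`** — (1.55) abelian at every bond for the
  lattice-unit Hodge term: from (1.9) for `U₁` pointwise (`≤ α₀(L^{j(b)})⁻²(L^{j(b)}η)⁻¹`) and (1.41) pointwise (`|A(b)| ≤ α₂(L^{j(b)}η)⁻¹`), `4Lα₂ ≤ 1`:
  `|(∂*₁∂₁A)(b)| ≤ η²(α₀ + (128/5)dL³α₂³)(L^{j(b)}η)⁻³`; §4.3 **`ineq155_abelian_kLevel`** — in the letters of `B8Prop3MultiLevelTorusP26` (`c′ ≠ 0` of either sign,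
  `η = |c′|⁻¹`, `J = dcsE c′ (dcE c′ A)`): `|J(b)| ≤ (α₀ + (128/5)dL³α₂³)(L^{j(b)}η)⁻³`; **`ineq155_abelian_kLevel_printed`** — PRINT'S (1.55) VERBATIM
  `|J(b)| ≤ (2α₀ + 36d_Pα₂X + 50d_Pα₂³ + 10d_Pα₀α₂)(L^{j(b)}η)⁻³` for every `X ≥ 0` (standing for `|∇^η_{U₀}A|₍₋₂₎`) and every `d_P ≥ d·L³`;
  `h40_of_bondClause19` — the pointwise (1.9) input from the typed class predicate `BondClause19 adU1 entryU1 (l ↦ {b : l ≤ j(b)}) k η L α₀ U₁`.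

HONEST SCOPE / NOT CLAIMED.  (i) ABELIAN GROUP ONLY (`U(1)`, real `A`): the non-abelian (1.43)–(1.55) with their commutator terms are the ℤᵈ files named above,
not this file; the `36dα₂|∇A|₍₋₂₎` and `10dα₀α₂` terms of (1.55) are genuinely absent here (not dropped by weakening), and print's (1.55) is implied.
(ii) `U₀ = 1` only (the flat background of the whole multi-level torus lane; Sect. F of the paper applies Theorems 2/4 with the background `1`, p. 97).
(iii) «on Ω_j»: hypotheses and conclusions are in the GLOBAL pointwise-by-level encoding of `B8Prop3MultiLevelTorusP26` (`j(b)` = the level of the initial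
point `b₋` in p21's territories; print's p. 77 bond convention «at least one end-point» is wider by boundary bonds) — the located one-layer-wider reading of
(1.41) costs the explicit factor `L³` (G-B8-16); the LOCAL theorem §3 has no such factor.  (iv) Constants: `|sin θ − θ| ≤ |θ|³/5` (print: `1/3!`),
`2(d−1)` plaquettes per bond (print's count), smallness `4Lα₂ ≤ 1` (resp. `t ≤ 1`) explicit; `R ≥ 1`, `M_h ≥ 1` for §4.1.  (v) (1.42)/(1.56) are NOT touched:
the non-linear average `Q_j(U₀, ηA)` of [3] is not modelled on the torus (ℤᵈ: `B8Eq156Prop4`).  (vi) No head moves: rows B8.Eq1.55 / B8.Eq1.54 / B8.Eq1.43 /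
B8.Eq1.40 / B8.Prop3 cells only.  NOT summit progress, NOT continuum, NOT Clay.

RELATED IN THE TREE, NOT DUPLICATED (stem check 2026-08-23T20:20Z: `ls Balaban1983to89 | grep -i 'Eq155\|Abelian'` = `B8Eq155JBound` (ℤᵈ lineage, one
level, global reading, general normed algebra), `B8Lemma1Abelian`, `B8Thm8FlatAbelianFamily` — no (1.55) on the V1 torus; `grep -l 'GaugeGroup' … | instances`
= `UnitaryModel` only — the cell's `U(1)` is `T4CubeChartCircle.U1`, REUSED): `B8Eq17ClassAkV1.BondClause19` (p40: (1.9) typed on `Setup.GaugeField`, any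
gauge group — USED BY NAME as the hypothesis shape, §4.3), `LatticeFieldCalculus.covDivPlaq`/`covDAdj`/`curl`/`pdiffAdj` (the (1.1)–(1.2) calculus),
`Setup.GaugeField.plaqHol`, `T4CubeChartCircle.U1`/`expU`/`ofCircle`/`norm_entry_eq_one` + `QuantumLattice.u1Rep` (the cell's `U(1)` and its angle chart),
`B8Eq12HodgeLaplacianV1.dcsE_apply` (own, gen 64: (1.2) at `U = 1` = `(dcE)†` pointwise), `B6SectAOperatorsV1.dcE/dcsE` (p21), `B6GlobalChartV1.PV/toBox/blkV1`
(r03), `B6MultiLevelTorusOperator.TDomains.sepT`, `B6MultiLevelBoxOperator.one_le_bigSide` (p21), `B4TorusKernel.torusSupNorm/circAbs_add_mul/circAbs_le_abs`,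
`B8Ineq159MultiLevelTorus.len_blkV1` (own), Mathlib `Real.sin_bound`, `Real.norm_exp_I_mul_ofReal_sub_one_le`, `Complex.exp_ofReal_mul_I_im` — all USED BY
NAME; nothing re-declared.
-/

open scoped BigOperators ComplexConjugate

namespace Literature.MathematicalPhysics.QuantumFieldTheory.Balaban1983to89.B8Eq155AbelianMultiLevelTorus

open Finset LatticeFieldCalculus B6SectAOperatorsV1 GaugeField
open BalabanImbrieJaffe1984to88.BIJ85AxialPropagator411 (BondSpace PlaqSpace)
open T4CubeChartCircle (U1 expU ofCircle coe_ofCircle)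
open Literature.MathematicalPhysics.QuantumLattice (u1Rep u1Rep_apply)

noncomputable section

/-! ## §1. The abelian group `U(1)` of the cell read in `ℂ`: `R(U)X = UXU⁻¹ = X`, `ι(U) = U₁₁`, `U₁ = e^{iηA}` -/

section U1Dictionary

variable {P : Params} {j : ℕ}

/-- The ADJOINT ACTION `R(U)X = UXU⁻¹` of [B8] (1.1) for the abelian group `U(1)` (`1 × 1` unitaries), read on `M₁(ℂ) = ℂ`: the identity
(for `1 × 1` matrices `UXU⁻¹ = X`, `conj_eq_self_U1`). [cite: Balaban1985RegularSpaces, (1.1) p.76] -/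
def adU1 : U1 → ℂ →ₗ[ℝ] ℂ := fun _ => LinearMap.id

/-- The reading `ι : U(1) ⊂ M₁(ℂ) = ℂ` of a `1 × 1` unitary as a complex number (its entry). [cite: Balaban1985RegularSpaces, (1.9) p.77] -/
def entryU1 (U : U1) : ℂ := (U : Matrix (Fin 1) (Fin 1) ℂ) 0 0

/-- **`U₁ = e^{iηA}`** ([B8] (1.41) p. 83, verbatim: *"U₁ = e^{iηA}, |A| < α₂(Lʲη)⁻¹ on Ω_j"*) for the abelian group: the `U(1)`-valued
configuration of a REAL bond function `A` (the Lie algebra of `U(1)` is `iℝ`; `A` Hermitian = real), `U₁(b) = e^{iηA(b)}` — the cell's angle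
parametrisation `T4CubeChartCircle.expU`. [cite: Balaban1985RegularSpaces, (1.41) p.83] -/
def expCfg (η : ℝ) (A : VecField P j ℝ) : GaugeField P j U1 := fun b => expU (η * A b)

/-- `1 × 1` matrices commute with everything: `UXU⁻¹ = X` — the adjoint action of `U(1)` is trivial, justifying `adU1`.
[cite: Balaban1985RegularSpaces, (1.1) p.76] -/
theorem conj_eq_self_U1 (U : U1) (X : Matrix (Fin 1) (Fin 1) ℂ) :
    (U : Matrix (Fin 1) (Fin 1) ℂ) * X * ((U⁻¹ : U1) : Matrix (Fin 1) (Fin 1) ℂ) = X := by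
  have hc : (U : Matrix (Fin 1) (Fin 1) ℂ) * X = X * (U : Matrix (Fin 1) (Fin 1) ℂ) := by
    ext i k
    obtain rfl : i = 0 := Subsingleton.elim _ _
    obtain rfl : k = 0 := Subsingleton.elim _ _
    simp [Matrix.mul_apply, mul_comm]
  rw [hc, Matrix.mul_assoc]
  have h1 : (U : Matrix (Fin 1) (Fin 1) ℂ) * ((U⁻¹ : U1) : Matrix (Fin 1) (Fin 1) ℂ) = 1 := by
    rw [← Submonoid.coe_mul, mul_inv_cancel]; rfl
  rw [h1, Matrix.mul_one]

/-- `ι(e^{iθ}) = e^{iθ}`. [cite: Balaban1985RegularSpaces, (1.41) p.83] -/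
@[simp] theorem entryU1_expU (θ : ℝ) : entryU1 (expU θ) = Complex.exp (θ * Complex.I) := by
  simp [entryU1, expU, coe_ofCircle, u1Rep_apply, Circle.coe_exp]

/-- `‖ι(U)‖ = 1`. [cite: Balaban1985RegularSpaces, (1.9) p.77] -/
theorem norm_entryU1 (U : U1) : ‖entryU1 U‖ = 1 := T4CubeChartCircle.norm_entry_eq_one U

/-- `e^{iθ}e^{iθ′} = e^{i(θ+θ′)}`. [folklore] -/
private theorem expU_add (θ θ' : ℝ) : expU (θ + θ') = expU θ * expU θ' := by
  simp [expU, Circle.exp_add, map_mul]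

/-- `(e^{iθ})⁻¹ = e^{−iθ}`. [folklore] -/
private theorem expU_neg (θ : ℝ) : expU (-θ) = (expU θ)⁻¹ := by
  simp [expU, Circle.exp_neg, map_inv]

/-- **THE PLAQUETTE VARIABLE OF `U₁ = e^{iηA}` IS `e^{iη²(∂A)(p)}`** (abelian): `U₁(∂p) = e^{iη(A(b₁)+A(b₂)−A(b₃)−A(b₄))} = e^{iη·(∂₁A)(p)}`
with `∂₁A = curl 1 A` the plaquette sum ([B8] (1.47) at `U₀ = 1`: *"(∂_{U₀}U₁)(p) − 1 = iη²(D^η_{U₀}A)(p) − …"*, `η²D^ηA = η·curl 1 A`).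
[cite: Balaban1985RegularSpaces, (1.47) p.84, (1.21) p.79] -/
theorem plaqHol_expCfg (η : ℝ) (A : VecField P j ℝ) (p : Plaq P j) :
    plaqHol (expCfg η A) p = expU (η * curl 1 A p) := by
  simp only [plaqHol, expCfg, curl, one_smul]
  rw [show η * (A ⟨p.src, p.μ⟩ + A ⟨p.src.shift p.μ, p.ν⟩ - A ⟨p.src.shift p.ν, p.μ⟩ - A ⟨p.src, p.ν⟩)
      = η * A ⟨p.src, p.μ⟩ + η * A ⟨p.src.shift p.μ, p.ν⟩ + -(η * A ⟨p.src.shift p.ν, p.μ⟩) + -(η * A ⟨p.src, p.ν⟩) by ring,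
    expU_add, expU_add, expU_add, expU_neg, expU_neg]

/-- The same read in `ℂ`: `ι(U₁(∂p)) = exp(iθ(p))`, `θ(p) = η·(∂₁A)(p)`. [cite: Balaban1985RegularSpaces, (1.47) p.84] -/
theorem entryU1_plaqHol_expCfg (η : ℝ) (A : VecField P j ℝ) (p : Plaq P j) :
    entryU1 (plaqHol (expCfg η A) p) = Complex.exp ((η * curl 1 A p : ℝ) * Complex.I) := by
  rw [plaqHol_expCfg, entryU1_expU]

end U1Dictionary

/-! ## §2. [B8] (1.2) at an ABELIAN configuration: the covariant divergence `D^{η*}_{U₁}` IS the flat `∂*` (the adjoint action is trivial),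
and its imaginary part on `e^{iθ}` is `∂*(sin θ)` -/

section FlatDivergence

variable {P : Params} {j : ℕ}

/-- (1.1) for `U(1)`: `(D^{η*}_{U,ν}f)(x) = c(R(U(x, x−e_ν))f(x−e_ν) − f(x)) = c(f(x−e_ν) − f(x)) = (∂*_νf)(x)` for EVERY configuration `U`
(`R ≡ id`). [cite: Balaban1985RegularSpaces, (1.1) p.76] -/
theorem covDAdj_adU1 (c : ℝ) (U : GaugeField P j U1) (ν : Fin P.d) (f : SiteField P j ℂ) :
    covDAdj adU1 c U ν f = pdiffAdj c ν f := by
  funext x; rfl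

/-- **(1.2) for `U(1)` is the flat divergence** `(D^{η*}_U F)_μ(x) = Σ_{ν<μ}(∂*_νF_{νμ})(x) − Σ_{ν>μ}(∂*_νF_{μν})(x)`, whatever `U`.
[cite: Balaban1985RegularSpaces, (1.2) p.76] -/
theorem covDivPlaq_adU1 (c : ℝ) (U : GaugeField P j U1) (F : Plaq P j → ℂ) (b : PBond P j) :
    covDivPlaq adU1 c U F b
      = (∑ ν, if h : ν < b.dir then pdiffAdj c ν (fun z => F ⟨z, ν, b.dir, h⟩) b.src else 0)
        - ∑ ν, if h : b.dir < ν then pdiffAdj c ν (fun z => F ⟨z, b.dir, ν, h⟩) b.src else 0 := by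
  simp only [covDivPlaq, covDAdj_adU1]

/-- In particular it does not depend on the configuration. [cite: Balaban1985RegularSpaces, (1.2) p.76] -/
theorem covDivPlaq_adU1_eq_one (c : ℝ) (U : GaugeField P j U1) (F : Plaq P j → ℂ) :
    covDivPlaq adU1 c U F = covDivPlaq adU1 c 1 F := by
  funext b; rw [covDivPlaq_adU1, covDivPlaq_adU1]

/-- **IMAGINARY PART = `∂*` OF THE IMAGINARY PART** (level `0`, the V1 `ℓ²` carriers): `Im (D^{η*}_U F)(b) = (∂*(Im F))(b)` with `∂* = dcsE c`
the `ℓ²`-adjoint of the curl (`B8Eq12HodgeLaplacianV1.dcsE_apply` = (1.2) at `U = 1`). [cite: Balaban1985RegularSpaces, (1.2) p.76] -/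
theorem im_covDivPlaq_adU1 (c : ℝ) (U : GaugeField P 0 U1) (F : Plaq P 0 → ℂ) (b : PBond P 0) :
    (covDivPlaq adU1 c U F b).im = dcsE c (WithLp.toLp 2 fun p => (F p).im) b := by
  rw [covDivPlaq_adU1, B8Eq12HodgeLaplacianV1.dcsE_apply]
  simp [pdiffAdj, Complex.im_sum, apply_dite Complex.im]

/-- The flat divergence of a REAL plaquette function read in `ℂ` is real, and equals `∂*`: `(D^{η*}_U (g : ℂ))(b) = ((∂*g)(b) : ℂ)`.
[cite: Balaban1985RegularSpaces, (1.2) p.76] -/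
theorem covDivPlaq_adU1_ofReal (c : ℝ) (U : GaugeField P 0 U1) (g : Plaq P 0 → ℝ) (b : PBond P 0) :
    covDivPlaq adU1 c U (fun p => (g p : ℂ)) b = (dcsE c (WithLp.toLp 2 g) b : ℂ) := by
  rw [covDivPlaq_adU1, B8Eq12HodgeLaplacianV1.dcsE_apply]
  push_cast
  simp [pdiffAdj, apply_dite (fun r : ℝ => (r : ℂ))]

/-- **POINTWISE SIZE OF `∂*`**: if `|g| ≤ M` on the `2(d−1)` plaquettes through the bond `b = ⟨x, x + e_μ⟩` (the plaquettes `p_{νμ}(x)`,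
`p_{νμ}(x − e_ν)`, `ν < μ`, and `p_{μν}(x)`, `p_{μν}(x − e_ν)`, `ν > μ`), then `|(∂*g)(b)| ≤ |c|·2(d−1)·M` ([B8] p. 84: *"If we apply the
derivative D^{η*}_{U₀} … the derivative of these two terms can be bounded by …"* — the passage from a plaquette bound to a bond bound costs
the factor `2(d−1)η⁻¹`, print's `4α → 8dα·η⁻¹`). [cite: Balaban1985RegularSpaces, p.84 (after (1.43)), (1.2) p.76] -/
theorem abs_dcsE_apply_le {c M : ℝ} (g : PlaqSpace P) (b : PBond P 0)
    (h₁ : ∀ (ν : Fin P.d) (h : ν < b.dir) (y : Site P 0), (y = b.src ∨ y.shift ν = b.src) → |g ⟨y, ν, b.dir, h⟩| ≤ M)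
    (h₂ : ∀ (ν : Fin P.d) (h : b.dir < ν) (y : Site P 0), (y = b.src ∨ y.shift ν = b.src) → |g ⟨y, b.dir, ν, h⟩| ≤ M) :
    |dcsE c g b| ≤ |c| * (2 * ((P.d : ℝ) - 1) * M) := by
  classical
  rw [B8Eq12HodgeLaplacianV1.dcsE_apply]
  have hsu : ∀ (ν : Fin P.d) (y : Site P 0), (y.unshift ν).shift ν = y := fun ν y => by
    funext κ
    by_cases hκ : κ = ν
    · subst hκ; simp [Site.shift, Site.unshift]
    · simp [Site.shift, Site.unshift, Function.update_of_ne hκ]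
  -- each term `∂*_ν` costs `|c|·2M`, and there are `#{ν ≠ μ} = d − 1` of them
  have hterm : ∀ ν, |(if h : ν < b.dir then pdiffAdj c ν (fun z => g ⟨z, ν, b.dir, h⟩) b.src else 0)
      - (if h : b.dir < ν then pdiffAdj c ν (fun z => g ⟨z, b.dir, ν, h⟩) b.src else 0)|
      ≤ if ν = b.dir then 0 else |c| * (2 * M) := by
    intro ν
    by_cases hlt : ν < b.dir
    · rw [dif_pos hlt, dif_neg (lt_asymm hlt), if_neg hlt.ne, sub_zero, pdiffAdj, smul_eq_mul, abs_mul]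
      refine mul_le_mul_of_nonneg_left ?_ (abs_nonneg c)
      have ha := h₁ ν hlt (b.src.unshift ν) (Or.inr (hsu ν b.src))
      have hb := h₁ ν hlt b.src (Or.inl rfl)
      calc |g ⟨b.src.unshift ν, ν, b.dir, hlt⟩ - g ⟨b.src, ν, b.dir, hlt⟩|
          ≤ |g ⟨b.src.unshift ν, ν, b.dir, hlt⟩| + |g ⟨b.src, ν, b.dir, hlt⟩| := abs_sub _ _
        _ ≤ M + M := add_le_add ha hb
        _ = 2 * M := by ring
    · by_cases hgt : b.dir < ν
      · rw [dif_neg hlt, dif_pos hgt, if_neg hgt.ne', zero_sub, abs_neg, pdiffAdj, smul_eq_mul, abs_mul]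
        refine mul_le_mul_of_nonneg_left ?_ (abs_nonneg c)
        have ha := h₂ ν hgt (b.src.unshift ν) (Or.inr (hsu ν b.src))
        have hb := h₂ ν hgt b.src (Or.inl rfl)
        calc |g ⟨b.src.unshift ν, b.dir, ν, hgt⟩ - g ⟨b.src, b.dir, ν, hgt⟩|
            ≤ |g ⟨b.src.unshift ν, b.dir, ν, hgt⟩| + |g ⟨b.src, b.dir, ν, hgt⟩| := abs_sub _ _
          _ ≤ M + M := add_le_add ha hb
          _ = 2 * M := by ring
      · have heq : ν = b.dir := le_antisymm (not_lt.mp hgt) (not_lt.mp hlt)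
        rw [dif_neg hlt, dif_neg hgt, if_pos heq, sub_zero, abs_zero]
  rw [← Finset.sum_sub_distrib]
  calc |∑ ν, ((if h : ν < b.dir then pdiffAdj c ν (fun z => g ⟨z, ν, b.dir, h⟩) b.src else 0)
          - (if h : b.dir < ν then pdiffAdj c ν (fun z => g ⟨z, b.dir, ν, h⟩) b.src else 0))|
      ≤ ∑ ν, |(if h : ν < b.dir then pdiffAdj c ν (fun z => g ⟨z, ν, b.dir, h⟩) b.src else 0)
          - (if h : b.dir < ν then pdiffAdj c ν (fun z => g ⟨z, b.dir, ν, h⟩) b.src else 0)| := Finset.abs_sum_le_sum_abs _ _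
    _ ≤ ∑ ν, (if ν = b.dir then 0 else |c| * (2 * M)) := Finset.sum_le_sum fun ν _ => hterm ν
    _ = |c| * (2 * ((P.d : ℝ) - 1) * M) := by
        rw [Finset.sum_ite, Finset.sum_const_zero, zero_add, Finset.sum_const, nsmul_eq_mul]
        have hcard : ((Finset.univ.filter fun ν : Fin P.d => ¬ν = b.dir).card : ℝ) = (P.d : ℝ) - 1 := by
          rw [Finset.filter_ne' Finset.univ b.dir, Finset.card_erase_of_mem (Finset.mem_univ _), Finset.card_univ,
            Fintype.card_fin]
          have h1 : 1 ≤ P.d := P.hd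
          push_cast [Nat.cast_sub h1]
          ring
        rw [hcard]; ring

end FlatDivergence

/-! ## §3. (1.47)–(1.55) AT ONE BOND for `U(1)`, `U₀ = 1`: the third-order expansion of `e^{iθ}` and the basic estimate -/

section Local

variable {P : Params}

/-- The THIRD-ORDER TAYLOR REMAINDER of the plaquette variable, abelian case ([B8] (1.47): *"(∂_{U₀}U₁)(p) − 1 = iη²(D^η_{U₀}A)(p) −
½η²V₂(U₀, A, ∂p) + O₁((1/3!)η³(∂|A|(p))³)"* with `V₂ = η²(D^ηA)²` REAL for `U(1)`): for the imaginary part, `|sin θ − θ| ≤ |θ|³/5`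
on `|θ| ≤ 1` (Mathlib's `Real.sin_bound`: `|sin θ − (θ − θ³/6)| ≤ |θ|⁵/100`; `1/6 + 1/100 ≤ 1/5`). [cite: Balaban1985RegularSpaces, (1.47) p.84] -/
theorem abs_sin_sub_self_le {θ : ℝ} (hθ : |θ| ≤ 1) : |Real.sin θ - θ| ≤ |θ| ^ 3 / 5 := by
  have h := Real.sin_bound hθ
  have h3 : |θ ^ 3 / 6| = |θ| ^ 3 / 6 := by rw [abs_div, abs_pow, abs_of_pos (by norm_num : (0 : ℝ) < 6)]
  have h5 : |θ| ^ 5 ≤ |θ| ^ 3 := by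
    have h0 : 0 ≤ |θ| := abs_nonneg θ
    calc |θ| ^ 5 = |θ| ^ 3 * (|θ| * |θ|) := by ring
      _ ≤ |θ| ^ 3 * (1 * 1) := by gcongr
      _ = |θ| ^ 3 := by ring
  calc |Real.sin θ - θ| = |(Real.sin θ - (θ - θ ^ 3 / 6)) + (-(θ ^ 3 / 6))| := by ring_nf
    _ ≤ |Real.sin θ - (θ - θ ^ 3 / 6)| + |-(θ ^ 3 / 6)| := abs_add_le _ _
    _ ≤ |θ| ^ 5 / 100 + |θ| ^ 3 / 6 := by rw [abs_neg, h3]; exact add_le_add h (le_refl _)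
    _ ≤ |θ| ^ 3 / 100 + |θ| ^ 3 / 6 := by gcongr
    _ ≤ |θ| ^ 3 / 5 := by nlinarith [pow_nonneg (abs_nonneg θ) 3]

/-- `∂` on vector fields is homogeneous in the lattice factor: `dcE c A = c • dcE 1 A`. [cite: Balaban1984PropagatorsI, (1.2) p.18] -/
theorem dcE_eq_smul_one (c : ℝ) (A : BondSpace P) : dcE c A = c • dcE 1 A := by
  ext p
  simp [dcE_apply, curl]

/-- `∂*` on plaquette functions is homogeneous in the lattice factor: `(dcsE c F)(b) = c·(dcsE 1 F)(b)`. [cite: Balaban1985RegularSpaces, (1.2) p.76] -/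
theorem dcsE_apply_eq_mul_one (c : ℝ) (F : PlaqSpace P) (b : PBond P 0) : dcsE c F b = c * dcsE 1 F b := by
  have h : dcE (P := P) c = c • dcE 1 := LinearMap.ext (dcE_eq_smul_one c)
  have h2 : dcsE (P := P) c = c • dcsE 1 := by
    show LinearMap.adjoint (dcE (P := P) c) = c • LinearMap.adjoint (dcE (P := P) 1)
    rw [h, map_smulₛₗ, starRingEnd_apply, star_trivial]
  rw [h2, LinearMap.smul_apply, PiLp.smul_apply, smul_eq_mul]

/-- `J = D^{η*}D^ηA` at `U₀ = 1` scales with the square of the lattice factor: `(∂*_c∂_cA)(b) = c²·(∂*₁∂₁A)(b)` (so with `c = ±η⁻¹`,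
`η²J = ∂*₁∂₁A`). [cite: Balaban1985RegularSpaces, (1.55) p.86] -/
theorem hodge_apply_eq_sq_mul (c : ℝ) (A : BondSpace P) (b : PBond P 0) :
    dcsE c (dcE c A) b = c ^ 2 * dcsE 1 (dcE 1 A) b := by
  rw [dcE_eq_smul_one c A, map_smul, PiLp.smul_apply, smul_eq_mul, dcsE_apply_eq_mul_one c]
  ring

/-- **(1.54) ⇒ (1.55) AT ONE BOND, ABELIAN, `U₀ = 1`** — the basic estimate at the bond `b = ⟨x, x + e_μ⟩`.  PRINT (p. 85–86):
*"D^{η*}_{U₁U₀}∂U₁U₀ = D^{η*}_{U₀}∂U₀ + iη²D^{η*}_{U₀}D^η_{U₀}A + O₁(36dα₂(Lʲη)⁻¹|∇^η_{U₀}A|η²) + O₁(50dα₂³(Lʲη)⁻³η²) + O₁(10dα₀α₂(Lʲη)⁻³η²)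
on Ω_j (1.54) … From (1.40) the term on the left-hand side and the first term on the right-hand side can be estimated by α₀(Lʲη)⁻³η². This
implies that D^{η*}_{U₀}D^η_{U₀}A = J, |J| ≦ (2α₀ + 36dα₂(Lʲη)²|∇^η_{U₀}A| + 50dα₂³ + 10dα₀α₂)(Lʲη)⁻³ (1.55)"*.  HERE, for `U(1)` and `U₀ = 1`
(so `∂U₀ ≡ 1`, `D^{η*}_{U₁U₀} = D^{η*}_{U₁}` = the flat `∂*` by §2, `U₁(∂p) = e^{iθ(p)}`, `θ = η·(∂₁A) = η²D^ηA`): the IMAGINARY PART of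
`D^{η*}_{U₁}∂U₁` is `∂*(sin θ) = ∂*θ − ∂*(θ − sin θ) = η⁻¹·η·∂*₁∂₁A − ∂*(θ − sin θ)` (the real part carries `½η²D*V₂ = ½∂*(θ²)`, which for
`U(1)` is the whole of (1.49)–(1.53): the commutator brace of (1.50) vanishes), whence
`|(∂*₁∂₁A)(b)| ≤ |(D^{η*}_{U₁}∂U₁)(b)| + η⁻¹·2(d−1)·t³/5` whenever `|θ| ≤ t ≤ 1` on the `2(d−1)` plaquettes through `b` ((1.47)–(1.48): the
third-order remainder through `2(d−1)` plaquettes and one `η⁻¹`).  Any torus `T_η = Site P 0`, any `η > 0`; the (1.9) quantity is EXACTLY the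
one of p40's `B8Eq17ClassAkV1.BondClause19` (`covDivPlaq R η⁻¹ U (ι ∘ U(∂·))` with `R = adU1`, `ι = entryU1`).
[cite: Balaban1985RegularSpaces, (1.54)–(1.55) pp.85–86, (1.47)–(1.48) p.84] -/
theorem abs_hodge_le_loc {η t : ℝ} (hη : 0 < η) (ht : t ≤ 1) (A : BondSpace P) (b : PBond P 0)
    (h₁ : ∀ (ν : Fin P.d) (h : ν < b.dir) (y : Site P 0), (y = b.src ∨ y.shift ν = b.src) →
      |η * curl 1 (WithLp.ofLp A) ⟨y, ν, b.dir, h⟩| ≤ t)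
    (h₂ : ∀ (ν : Fin P.d) (h : b.dir < ν) (y : Site P 0), (y = b.src ∨ y.shift ν = b.src) →
      |η * curl 1 (WithLp.ofLp A) ⟨y, b.dir, ν, h⟩| ≤ t) :
    |dcsE 1 (dcE 1 A) b|
      ≤ ‖covDivPlaq adU1 η⁻¹ (expCfg η (WithLp.ofLp A)) (fun p => entryU1 (plaqHol (expCfg η (WithLp.ofLp A)) p)) b‖
        + η⁻¹ * (2 * ((P.d : ℝ) - 1) * (t ^ 3 / 5)) := by
  -- the phase `θ(p) = η·(∂₁A)(p)` and the third-order remainder `r = θ − sin θ`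
  set θ : Plaq P 0 → ℝ := fun p => η * curl 1 (WithLp.ofLp A) p with hθ
  set r : Plaq P 0 → ℝ := fun p => θ p - Real.sin (θ p) with hr
  set DF := covDivPlaq adU1 η⁻¹ (expCfg η (WithLp.ofLp A)) (fun p => entryU1 (plaqHol (expCfg η (WithLp.ofLp A)) p)) b with hDF
  -- Im (D^{η*}_{U₁}∂U₁)(b) = (∂*(sin θ))(b)
  have hfun : (fun p => (entryU1 (plaqHol (expCfg η (WithLp.ofLp A)) p)).im) = fun p => Real.sin (θ p) :=
    funext fun p => by rw [entryU1_plaqHol_expCfg, Complex.exp_ofReal_mul_I_im]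
  have him : DF.im = dcsE η⁻¹ (WithLp.toLp 2 fun p => Real.sin (θ p)) b := by
    rw [hDF, im_covDivPlaq_adU1, hfun]
  -- sin θ = θ − r, and (toLp θ) = η • ∂₁A
  have hsin : (WithLp.toLp 2 fun p => Real.sin (θ p) : PlaqSpace P) = η • dcE 1 A - WithLp.toLp 2 r := by
    ext p
    simp [hr, hθ, dcE_apply]
  have hmain : dcsE 1 (dcE 1 A) b = DF.im + dcsE η⁻¹ (WithLp.toLp 2 r) b := by
    rw [him, hsin, map_sub, map_smul, PiLp.sub_apply, PiLp.smul_apply, smul_eq_mul, dcsE_apply_eq_mul_one η⁻¹ (dcE 1 A)]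
    field_simp
    ring
  -- the remainder through the `2(d−1)` plaquettes: `|r| ≤ t³/5`
  have hrp : ∀ p, |θ p| ≤ t → |(WithLp.toLp 2 r : PlaqSpace P) p| ≤ t ^ 3 / 5 := by
    intro p hp
    have h1 : |θ p| ≤ 1 := hp.trans ht
    have e : (WithLp.toLp 2 r : PlaqSpace P) p = θ p - Real.sin (θ p) := rfl
    rw [e, abs_sub_comm]
    calc |Real.sin (θ p) - θ p| ≤ |θ p| ^ 3 / 5 := abs_sin_sub_self_le h1
      _ ≤ t ^ 3 / 5 := by gcongr
  have hrem : |dcsE η⁻¹ (WithLp.toLp 2 r) b| ≤ |η⁻¹| * (2 * ((P.d : ℝ) - 1) * (t ^ 3 / 5)) :=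
    abs_dcsE_apply_le _ b (fun ν h y hy => hrp _ (h₁ ν h y hy)) (fun ν h y hy => hrp _ (h₂ ν h y hy))
  rw [abs_of_pos (inv_pos.mpr hη)] at hrem
  rw [hmain]
  exact (abs_add_le _ _).trans (add_le_add (Complex.abs_im_le_norm DF) hrem)

/-- **(1.41) ⇒ (1.8) for `U₁`** (p. 84, verbatim: *"Because ∂_{U₀}U₁ − 1 = O₁(4α₂(Lʲη)⁻¹η)"*; (1.8) p. 77 «|U(∂p) − 1| < α₀η²(Lʲη)⁻²»):
`|U₁(∂p) − 1| = |e^{iθ(p)} − 1| ≤ |θ(p)| = η|(∂₁A)(p)|` (≤ `4η·max|A|` by `abs_curl_one_le`). [cite: Balaban1985RegularSpaces, p.84 (before (1.46)), (1.8) p.77] -/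
theorem norm_entryU1_plaqHol_sub_one_le (η : ℝ) (A : VecField P 0 ℝ) (p : Plaq P 0) :
    ‖entryU1 (plaqHol (expCfg η A) p) - 1‖ ≤ |η * curl 1 A p| := by
  rw [entryU1_plaqHol_expCfg, mul_comm, ← Real.norm_eq_abs]
  exact Real.norm_exp_I_mul_ofReal_sub_one_le

/-- The plaquette sum is at most four bond values: `|(∂₁A)(p)| ≤ |A(b₁)| + |A(b₂)| + |A(b₃)| + |A(b₄)|` (p. 84: *"∂_{U₀}U₁ − 1 =
O₁(4α₂(Lʲη)⁻¹η)"*). [cite: Balaban1985RegularSpaces, p.84 (before (1.46))] -/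
theorem abs_curl_one_le (A : VecField P 0 ℝ) (p : Plaq P 0) :
    |curl 1 A p| ≤ |A ⟨p.src, p.μ⟩| + |A ⟨p.src.shift p.μ, p.ν⟩| + |A ⟨p.src.shift p.ν, p.μ⟩| + |A ⟨p.src, p.ν⟩| := by
  simp only [curl, one_smul]
  have := abs_add_le (A ⟨p.src, p.μ⟩ + A ⟨p.src.shift p.μ, p.ν⟩ - A ⟨p.src.shift p.ν, p.μ⟩) (-A ⟨p.src, p.ν⟩)
  have := abs_add_le (A ⟨p.src, p.μ⟩ + A ⟨p.src.shift p.μ, p.ν⟩) (-A ⟨p.src.shift p.ν, p.μ⟩)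
  have := abs_add_le (A ⟨p.src, p.μ⟩) (A ⟨p.src.shift p.μ, p.ν⟩)
  simp only [abs_neg, ← sub_eq_add_neg] at *
  linarith

end Local

/-! ## §4. (1.55) ON THE `k`-LEVEL V1 TORUS: levels by r03's `blkV1`, «on Ω_j» in the global encoding of `B8Prop3MultiLevelTorusP26` -/

section KLevel

open B6GlobalChartV1 (PV toBox toBox_apply blkV1)
open B6MultiLevelBoxOperator (N0 bigSide one_le_bigSide)
open B6MultiLevelTorusOperator (TDomains)
open B6Geom246MultiLevelTorus (geomT)
open B4TorusKernel.MultiPeriod (torusSupNorm circAbs circAbs_add_mul circAbs_le_abs)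
open B8Ineq159MultiLevelTorus (len_blkV1)

variable {d ℓ m K : ℕ} {hd : 1 ≤ d + 1} {hL : Odd (ℓ + 1) ∧ 1 < ℓ + 1}

/-! ### §4.1 Neighbouring sites of the torus have neighbouring levels ((1.4)/(2.2): `dist(Ω_j^c, Ω_{j+1}) > RM·Lʲη ≥ η`) -/

/-- Sites whose labels differ by `0, ±1` modulo the period in every coordinate are at torus sup-distance `≤ 1` in p21's fundamental-box
chart (`B6GlobalChartV1.toBox`, `B4TorusKernel.torusSupNorm`). [cite: Balaban1984PropagatorsII, (2.2) p.224, dictionary] -/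
theorem torusSupNorm_le_one_of_near {Mh k : ℕ} {P' : Fin (d + 1) → ℕ} (hN : ∀ μ, N0 ℓ Mh k P' μ = (PV d ℓ m K hd hL).sitesPerDir 0)
    {x y : Site (PV d ℓ m K hd hL) 0} (hxy : ∀ i, ∃ δ : ℤ, |δ| ≤ 1 ∧ y i = x i + (δ : ZMod _)) :
    torusSupNorm (N0 ℓ Mh k P') ((toBox hN y : Fin (d + 1) → ℤ) - (toBox hN x : Fin (d + 1) → ℤ)) ≤ 1 := by
  unfold torusSupNorm
  refine Finset.sup'_le _ _ fun i _ => ?_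
  obtain ⟨δ, hδ, hi⟩ := hxy i
  have hn : 1 ≤ N0 ℓ Mh k P' i := by
    rw [hN i]; exact Nat.one_le_iff_ne_zero.mpr ((PV d ℓ m K hd hL).sitesPerDir_ne_zero 0)
  have hdvd : ((N0 ℓ Mh k P' i : ℕ) : ℤ) ∣ (((y i).val : ℤ) - ((x i).val : ℤ) - δ) := by
    rw [hN i, ← ZMod.intCast_zmod_eq_zero_iff_dvd]
    push_cast
    rw [ZMod.natCast_zmod_val, ZMod.natCast_zmod_val, hi]
    ring
  obtain ⟨q, hq⟩ := hdvd
  have hcoord : ((toBox hN y : Fin (d + 1) → ℤ) - (toBox hN x : Fin (d + 1) → ℤ)) i = δ + (N0 ℓ Mh k P' i) * q := by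
    simp only [Pi.sub_apply, toBox_apply]; linarith
  rw [hcoord, circAbs_add_mul]
  exact_mod_cast (circAbs_le_abs hn δ).trans hδ

/-- **NEIGHBOURING SITES HAVE NEIGHBOURING LEVELS** on p21's `k`-level torus family: if `y` is within torus sup-distance `1` of `x` then
`j(x) ≤ j(y) + 1` — from the separation (2.2)/(1.4) *"(Lʲη)⁻¹dist(Ω_j^c, Ω_{j+1}) > RM₁"* (`TDomains.sepT`, `R ≥ 1`, `M_h ≥ 1`): a site of
`Ω_{j+1}` has all its lattice neighbours in `Ω_j`. [cite: Balaban1985RegularSpaces, (1.4) p.77; Balaban1984PropagatorsII, (2.2) p.224] -/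
theorem lev_le_lev_add_one_of_near {Mh k R : ℕ} {P' : Fin (d + 1) → ℕ} (hN : ∀ μ, N0 ℓ Mh k P' μ = (PV d ℓ m K hd hL).sitesPerDir 0)
    (D : TDomains d ℓ Mh k P' R) (hR : 1 ≤ R) (hMh : 1 ≤ Mh) {x y : Site (PV d ℓ m K hd hL) 0}
    (hxy : torusSupNorm (N0 ℓ Mh k P') ((toBox hN y : Fin (d + 1) → ℤ) - (toBox hN x : Fin (d + 1) → ℤ)) ≤ 1) :
    D.lev (toBox hN x : Fin (d + 1) → ℤ) ≤ D.lev (toBox hN y : Fin (d + 1) → ℤ) + 1 := by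
  by_contra h
  have hlt : D.lev (toBox hN y : Fin (d + 1) → ℤ) + 1 < D.lev (toBox hN x : Fin (d + 1) → ℤ) := not_le.mp h
  have hsep := D.sepT (D.lev (toBox hN y : Fin (d + 1) → ℤ) + 1) (toBox hN y) (toBox hN y).2 (toBox hN x) (toBox hN x).2
    (by omega) (by omega)
  have h1 : 1 ≤ R * bigSide ℓ Mh (D.lev (toBox hN y : Fin (d + 1) → ℤ) + 1) :=
    le_trans (one_le_bigSide hMh _) (Nat.le_mul_of_pos_left _ hR)
  have h1' : (1 : ℝ) ≤ ((R * bigSide ℓ Mh (D.lev (toBox hN y : Fin (d + 1) → ℤ) + 1) : ℕ) : ℝ) := by exact_mod_cast h1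
  linarith

/-- `x` is near itself. [folklore] -/
private theorem near_refl {n : ℕ} {ι : Type*} (x : ι → ZMod n) : ∀ i, ∃ δ : ℤ, |δ| ≤ 1 ∧ x i = x i + (δ : ZMod n) :=
  fun _ => ⟨0, by simp, by simp⟩

/-- `x + e_κ` is near `x`. [folklore] -/
private theorem near_shift {P : Params} {j : ℕ} (x : Site P j) (κ : Fin P.d) :
    ∀ i, ∃ δ : ℤ, |δ| ≤ 1 ∧ x.shift κ i = x i + (δ : ZMod _) := by
  intro i
  by_cases hi : i = κ
  · subst hi; exact ⟨1, by simp, by simp [Site.shift]⟩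
  · exact ⟨0, by simp, by simp [Site.shift, Function.update_of_ne hi]⟩

/-- `x − e_ν` is near `x` (the site `y` with `y + e_ν = x`). [folklore] -/
private theorem near_of_shift_eq {P : Params} {j : ℕ} {x y : Site P j} {ν : Fin P.d} (h : y.shift ν = x) :
    ∀ i, ∃ δ : ℤ, |δ| ≤ 1 ∧ y i = x i + (δ : ZMod _) := by
  intro i
  subst h
  by_cases hi : i = ν
  · subst hi; exact ⟨-1, by simp, by simp [Site.shift]⟩
  · exact ⟨0, by simp, by simp [Site.shift, Function.update_of_ne hi]⟩

/-- `x − e_ν + e_κ` is near `x`. [folklore] -/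
private theorem near_shift_of_shift_eq {P : Params} {j : ℕ} {x y : Site P j} {ν : Fin P.d} (h : y.shift ν = x) (κ : Fin P.d) :
    ∀ i, ∃ δ : ℤ, |δ| ≤ 1 ∧ (y.shift κ) i = x i + (δ : ZMod _) := by
  intro i
  subst h
  by_cases hκ : κ = ν
  · subst hκ; exact ⟨0, by simp, by simp⟩
  by_cases hi : i = κ
  · subst hi
    refine ⟨1, by simp, ?_⟩
    simp [Site.shift, Function.update_of_ne hκ]
  · by_cases hi' : i = ν
    · subst hi'
      refine ⟨-1, by simp, ?_⟩
      simp [Site.shift, Function.update_of_ne hi]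
    · exact ⟨0, by simp, by simp [Site.shift, Function.update_of_ne hi, Function.update_of_ne hi']⟩

/-! ### §4.2 (1.55) at every bond of the `k`-level V1 torus, abelian case, `U₀ = 1` -/

/-- **[B8] (1.55) DERIVED AT `U₀ = 1` FOR `U(1)` ON THE `k`-LEVEL V1 TORUS (lattice-unit Hodge term).**  PRINT (p. 86 [PDF 12], verbatim): *"We will
apply it to get regularity results for A, assuming (1.40)–(1.42). From (1.40) the term on the left-hand side and the first term on the right-hand
side can be estimated by α₀(Lʲη)⁻³η². This implies that D^{η*}_{U₀}D^η_{U₀}A = J, |J| ≦ (2α₀ + 36dα₂(Lʲη)²|∇^η_{U₀}A| + 50dα₂³ + 10dα₀α₂)(Lʲη)⁻³,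
(1.55) or |J|₍₋₃₎ ≦ 2α₀ + 36dα₂|∇^η_{U₀}A|₍₋₂₎ + 50dα₂³ + 10dα₀α₂"*; (1.40)–(1.41) p. 83: *"U₀, U₁U₀ ∈ 𝔄_k({Ω_j}, α₀) … (1.40)  U₁ = e^{iηA},
|A| < α₂(Lʲη)⁻¹ on Ω_j, (1.41)"*; (1.9) p. 77: *"|(D^{η*}_U ∂U)(b)| < α₀L^{−2j}(Lʲη)⁻¹ for b ∈ Ω_j"*.  TYPED READING at the flat background on
p21's torus family `TDomains d ℓ M_h k P′ R` carrying r03's V1 chart (`PV`, `blkV1`; the level of a bond is that of its initial point,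
`j(b) := lev(b₋)`, `(geomT D).len (blkV1 hN D b) = L^{j(b)}` by `B8Ineq159MultiLevelTorus.len_blkV1`), gauge group `U(1)` (`U1` of the cell), `U₀ = 1`,
`U₁ = e^{iηA}` (`expCfg η A`) for a REAL bond function `A`, spacing `η > 0`: IF (1.40) holds in its (1.9) member for `U₁` in the pointwise form
`|(D^{η*}_{U₁}∂U₁)(b)| ≤ α₀(L^{j(b)})⁻²(L^{j(b)}η)⁻¹` (the quantity of p40's `BondClause19` with `R = adU1`, `ι = entryU1`; `U₀ = 1` satisfies (1.9) with
`0`) AND (1.41) holds as `|A(b)| ≤ α₂(L^{j(b)}η)⁻¹` at every bond, with `4Lα₂ ≤ 1`, `R ≥ 1`, `M_h ≥ 1`, THEN at every bond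
`|(∂*₁∂₁A)(b)| ≤ η²·(α₀ + (128/5)·d·L³·α₂³)·(L^{j(b)}η)⁻³` — the abelian (1.55) for the lattice-unit Hodge term `η²J` (`d + 1` = the dimension,
so print's `d − 1 ↦ d`; the factor `L³` is the located one-layer-wider reading of «on Ω_j» in the `blkV1` encoding, cell GAPS G-B8-16: the sides of
a plaquette through `b` have levels `≥ j(b) − 1`, §4.1).  Proof = §3 at every bond with `t = 4Lα₂/L^{j(b)}`.
[cite: Balaban1985RegularSpaces, (1.55) p.86, (1.40)–(1.41) p.83, (1.9) p.77, (1.47)–(1.48) p.84, (1.54) p.85] -/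
theorem abs_hodge_one_le_kLevel {Mh k R : ℕ} {P' : Fin (d + 1) → ℕ} (hN : ∀ μ, N0 ℓ Mh k P' μ = (PV d ℓ m K hd hL).sitesPerDir 0)
    (D : TDomains d ℓ Mh k P' R) (hR : 1 ≤ R) (hMh : 1 ≤ Mh) {η α₀ α₂ : ℝ} (hη : 0 < η) (hα₂ : 0 ≤ α₂)
    (hsmall : 4 * ((ℓ : ℝ) + 1) * α₂ ≤ 1) (A : BondSpace (PV d ℓ m K hd hL))
    (h40 : ∀ b, ‖covDivPlaq adU1 η⁻¹ (expCfg η (WithLp.ofLp A)) (fun p => entryU1 (plaqHol (expCfg η (WithLp.ofLp A)) p)) b‖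
        ≤ α₀ * (((geomT D).len (blkV1 hN D b)) ^ 2)⁻¹ * ((geomT D).len (blkV1 hN D b) * η)⁻¹)
    (h41 : ∀ b, |A b| ≤ α₂ * ((geomT D).len (blkV1 hN D b) * η)⁻¹) (b : PBond (PV d ℓ m K hd hL) 0) :
    |dcsE 1 (dcE 1 A) b|
      ≤ η ^ 2 * (α₀ + 128 / 5 * d * ((ℓ : ℝ) + 1) ^ 3 * α₂ ^ 3) * (((geomT D).len (blkV1 hN D b) * η) ^ 3)⁻¹ := by
  -- letters: `Lr = L`, `ln b' = L^{j(b')}`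
  set Lr : ℝ := (ℓ : ℝ) + 1 with hLr
  have hLr1 : 1 ≤ Lr := by rw [hLr]; have : (0 : ℝ) ≤ ℓ := Nat.cast_nonneg ℓ; linarith
  have hLr0 : 0 < Lr := lt_of_lt_of_le one_pos hLr1
  have hlen : ∀ b' : PBond (PV d ℓ m K hd hL) 0,
      (geomT D).len (blkV1 hN D b') = Lr ^ D.lev (toBox hN b'.src : Fin (d + 1) → ℤ) := fun b' => len_blkV1 hN D b'
  have hlen_pos : ∀ b' : PBond (PV d ℓ m K hd hL) 0, 0 < (geomT D).len (blkV1 hN D b') := fun b' => by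
    rw [hlen]; positivity
  have hlen1 : ∀ b' : PBond (PV d ℓ m K hd hL) 0, 1 ≤ (geomT D).len (blkV1 hN D b') := fun b' => by
    rw [hlen]; exact one_le_pow₀ hLr1
  set ln : ℝ := (geomT D).len (blkV1 hN D b) with hln
  have hln0 : 0 < ln := hlen_pos b
  -- the sides of the plaquettes through `b`: sources near `b.src`, hence `|A(b′)| ≤ α₂·L·(L^{j(b)}η)⁻¹`
  have hside : ∀ b' : PBond (PV d ℓ m K hd hL) 0, (∀ i, ∃ δ : ℤ, |δ| ≤ 1 ∧ b'.src i = b.src i + (δ : ZMod _)) →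
      |A b'| ≤ α₂ * Lr * (ln * η)⁻¹ := by
    intro b' hnear
    have hlev : D.lev (toBox hN b.src : Fin (d + 1) → ℤ) ≤ D.lev (toBox hN b'.src : Fin (d + 1) → ℤ) + 1 :=
      lev_le_lev_add_one_of_near hN D hR hMh (torusSupNorm_le_one_of_near hN hnear)
    have hcmp : ln ≤ Lr * (geomT D).len (blkV1 hN D b') := by
      rw [hln, hlen, hlen, ← pow_succ']
      exact pow_le_pow_right₀ hLr1 hlev
    have hinv : ((geomT D).len (blkV1 hN D b') * η)⁻¹ ≤ Lr * (ln * η)⁻¹ := by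
      have hpos : 0 < ln * η / Lr := by positivity
      have hle : ln * η / Lr ≤ (geomT D).len (blkV1 hN D b') * η := by
        rw [div_le_iff₀ hLr0]
        calc ln * η ≤ (Lr * (geomT D).len (blkV1 hN D b')) * η := mul_le_mul_of_nonneg_right hcmp hη.le
          _ = (geomT D).len (blkV1 hN D b') * η * Lr := by ring
      calc ((geomT D).len (blkV1 hN D b') * η)⁻¹ ≤ (ln * η / Lr)⁻¹ := inv_anti₀ hpos hle
        _ = Lr * (ln * η)⁻¹ := by field_simp
    calc |A b'| ≤ α₂ * ((geomT D).len (blkV1 hN D b') * η)⁻¹ := h41 b'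
      _ ≤ α₂ * (Lr * (ln * η)⁻¹) := mul_le_mul_of_nonneg_left hinv hα₂
      _ = α₂ * Lr * (ln * η)⁻¹ := by ring
  -- the phase on the plaquettes through `b`: `|θ| ≤ t := 4Lα₂·η·(L^{j(b)}η)⁻¹ = 4Lα₂/L^{j(b)} ≤ 1`
  set t : ℝ := 4 * Lr * α₂ * (η * (ln * η)⁻¹) with ht
  have ht' : t = 4 * Lr * α₂ * ln⁻¹ := by
    rw [ht]; field_simp
  have ht1 : t ≤ 1 := by
    rw [ht']
    calc 4 * Lr * α₂ * ln⁻¹ ≤ 4 * Lr * α₂ * 1 := by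
          refine mul_le_mul_of_nonneg_left (inv_le_one_of_one_le₀ (hlen1 b)) (by positivity)
      _ ≤ 1 := by rw [mul_one]; exact hsmall
  have hθ : ∀ p : Plaq (PV d ℓ m K hd hL) 0,
      (∀ i, ∃ δ : ℤ, |δ| ≤ 1 ∧ p.src i = b.src i + (δ : ZMod _)) →
      (∀ i, ∃ δ : ℤ, |δ| ≤ 1 ∧ (p.src.shift p.μ) i = b.src i + (δ : ZMod _)) →
      (∀ i, ∃ δ : ℤ, |δ| ≤ 1 ∧ (p.src.shift p.ν) i = b.src i + (δ : ZMod _)) →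
      |η * curl 1 (WithLp.ofLp A) p| ≤ t := by
    intro p h0 hμ hν
    have hc := abs_curl_one_le (WithLp.ofLp A) p
    have e1 := hside ⟨p.src, p.μ⟩ h0
    have e2 := hside ⟨p.src.shift p.μ, p.ν⟩ hμ
    have e3 := hside ⟨p.src.shift p.ν, p.μ⟩ hν
    have e4 := hside ⟨p.src, p.ν⟩ h0
    rw [abs_mul, abs_of_pos hη, ht]
    have h4 : |curl 1 (WithLp.ofLp A) p| ≤ 4 * (α₂ * Lr * (ln * η)⁻¹) := by
      have := add_le_add (add_le_add (add_le_add e1 e2) e3) e4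
      exact hc.trans (by linarith)
    calc η * |curl 1 (WithLp.ofLp A) p| ≤ η * (4 * (α₂ * Lr * (ln * η)⁻¹)) := mul_le_mul_of_nonneg_left h4 hη.le
      _ = 4 * Lr * α₂ * (η * (ln * η)⁻¹) := by ring
  -- §3 at the bond `b`
  have hloc := abs_hodge_le_loc (P := PV d ℓ m K hd hL) hη ht1 A b
    (fun ν h y hy => by
      rcases hy with rfl | hy
      · exact hθ ⟨b.src, ν, b.dir, h⟩ (near_refl _) (near_shift _ _) (near_shift _ _)
      · have h2 : ∀ i, ∃ δ : ℤ, |δ| ≤ 1 ∧ (y.shift ν) i = b.src i + (δ : ZMod _) := by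
          rw [hy]; exact near_refl _
        exact hθ ⟨y, ν, b.dir, h⟩ (near_of_shift_eq hy) h2 (near_shift_of_shift_eq hy _))
    (fun ν h y hy => by
      rcases hy with rfl | hy
      · exact hθ ⟨b.src, b.dir, ν, h⟩ (near_refl _) (near_shift _ _) (near_shift _ _)
      · have h2 : ∀ i, ∃ δ : ℤ, |δ| ≤ 1 ∧ (y.shift ν) i = b.src i + (δ : ZMod _) := by
          rw [hy]; exact near_refl _
        exact hθ ⟨y, b.dir, ν, h⟩ (near_of_shift_eq hy) (near_shift_of_shift_eq hy _) h2)
  -- arithmetic: `(P.d − 1) = d`, `‖D*∂U₁(b)‖ ≤ α₀L^{−2j}(Lʲη)⁻¹ = α₀η²(Lʲη)⁻³`, `η⁻¹·2d·t³/5 = (128/5)dL³α₂³·η²(Lʲη)⁻³`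
  have hd' : ((PV d ℓ m K hd hL).d : ℝ) - 1 = d := by
    show ((d + 1 : ℕ) : ℝ) - 1 = d
    push_cast; ring
  rw [hd'] at hloc
  have e40 : α₀ * (ln ^ 2)⁻¹ * (ln * η)⁻¹ = η ^ 2 * α₀ * ((ln * η) ^ 3)⁻¹ := by
    field_simp
  have erem : η⁻¹ * (2 * (d : ℝ) * (t ^ 3 / 5)) = η ^ 2 * (128 / 5 * d * Lr ^ 3 * α₂ ^ 3) * ((ln * η) ^ 3)⁻¹ := by
    rw [ht']
    field_simp
    ring
  calc |dcsE 1 (dcE 1 A) b|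
      ≤ ‖covDivPlaq adU1 η⁻¹ (expCfg η (WithLp.ofLp A)) (fun p => entryU1 (plaqHol (expCfg η (WithLp.ofLp A)) p)) b‖
          + η⁻¹ * (2 * (d : ℝ) * (t ^ 3 / 5)) := hloc
    _ ≤ α₀ * (ln ^ 2)⁻¹ * (ln * η)⁻¹ + η⁻¹ * (2 * (d : ℝ) * (t ^ 3 / 5)) := by gcongr; exact h40 b
    _ = η ^ 2 * (α₀ + 128 / 5 * d * Lr ^ 3 * α₂ ^ 3) * ((ln * η) ^ 3)⁻¹ := by rw [e40, erem]; ring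

/-! ### §4.3 (1.55) in the letters of `B8Prop3MultiLevelTorusP26` (`η = |c′|⁻¹`, `J = ∂*_{c′}∂_{c′}A`) and in print's shape -/

/-- **[B8] (1.55) AT `U₀ = 1` FOR `U(1)` ON THE `k`-LEVEL V1 TORUS, IN THE LETTERS OF `B8Prop3MultiLevelTorusP26.prop3_multiLevelTorus_V1_P26_vector`**
(lattice factor `c′ ≠ 0` of either sign, spacing `η = |c′|⁻¹`, `J := ∂*_{c′}∂_{c′}A = dcsE c′ (dcE c′ A)` = «D^{η*}_{U₀}D^η_{U₀}A» at `U₀ = 1`):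
under (1.40) [(1.9) for `U₁ = e^{iηA}`] and (1.41), pointwise at every bond, `|J(b)| ≤ (α₀ + (128/5)·d·L³·α₂³)·(L^{j(b)}η)⁻³` — the abelian
(1.55), SHARPER than print's: no `|∇^η_{U₀}A|₍₋₂₎` term (it sits in the Hermitian part `½η²D^{η*}V₂`, (1.49)–(1.53), which the anti-Hermitian `iη²J`
does not see when the group is abelian) and no `10dα₀α₂` term (it comes from `U₀(∂p) − 1`, zero at `U₀ = 1`).
[cite: Balaban1985RegularSpaces, (1.55) p.86, (1.40)–(1.41) p.83, (1.9) p.77, (1.54) p.85] -/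
theorem ineq155_abelian_kLevel {Mh k R : ℕ} {P' : Fin (d + 1) → ℕ} (hN : ∀ μ, N0 ℓ Mh k P' μ = (PV d ℓ m K hd hL).sitesPerDir 0)
    (D : TDomains d ℓ Mh k P' R) (hR : 1 ≤ R) (hMh : 1 ≤ Mh) {cf α₀ α₂ : ℝ} (hcf : cf ≠ 0) (hα₂ : 0 ≤ α₂)
    (hsmall : 4 * ((ℓ : ℝ) + 1) * α₂ ≤ 1) (A : BondSpace (PV d ℓ m K hd hL))
    (h40 : ∀ b, ‖covDivPlaq adU1 |cf| (expCfg |cf|⁻¹ (WithLp.ofLp A)) (fun p => entryU1 (plaqHol (expCfg |cf|⁻¹ (WithLp.ofLp A)) p)) b‖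
        ≤ α₀ * (((geomT D).len (blkV1 hN D b)) ^ 2)⁻¹ * ((geomT D).len (blkV1 hN D b) * |cf|⁻¹)⁻¹)
    (h41 : ∀ b, |A b| ≤ α₂ * ((geomT D).len (blkV1 hN D b) * |cf|⁻¹)⁻¹) (b : PBond (PV d ℓ m K hd hL) 0) :
    |dcsE cf (dcE cf A) b| ≤ (α₀ + 128 / 5 * d * ((ℓ : ℝ) + 1) ^ 3 * α₂ ^ 3) * (((geomT D).len (blkV1 hN D b) * |cf|⁻¹) ^ 3)⁻¹ := by
  have hη : 0 < |cf|⁻¹ := inv_pos.mpr (abs_pos.mpr hcf)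
  have h40' : ∀ b', ‖covDivPlaq adU1 (|cf|⁻¹)⁻¹ (expCfg |cf|⁻¹ (WithLp.ofLp A))
      (fun p => entryU1 (plaqHol (expCfg |cf|⁻¹ (WithLp.ofLp A)) p)) b'‖
        ≤ α₀ * (((geomT D).len (blkV1 hN D b')) ^ 2)⁻¹ * ((geomT D).len (blkV1 hN D b') * |cf|⁻¹)⁻¹ := by
    intro b'; rw [inv_inv]; exact h40 b'
  have hk := abs_hodge_one_le_kLevel hN D hR hMh hη hα₂ hsmall A h40' h41 b
  rw [hodge_apply_eq_sq_mul, abs_mul, abs_pow, sq_abs]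
  have hcf2 : cf ^ 2 * |cf|⁻¹ ^ 2 = 1 := by
    rw [inv_pow, sq_abs, mul_inv_cancel₀ (pow_ne_zero 2 hcf)]
  calc cf ^ 2 * |dcsE 1 (dcE 1 A) b|
      ≤ cf ^ 2 * (|cf|⁻¹ ^ 2 * (α₀ + 128 / 5 * d * ((ℓ : ℝ) + 1) ^ 3 * α₂ ^ 3) * (((geomT D).len (blkV1 hN D b) * |cf|⁻¹) ^ 3)⁻¹) :=
        mul_le_mul_of_nonneg_left hk (sq_nonneg cf)
    _ = (cf ^ 2 * |cf|⁻¹ ^ 2) * ((α₀ + 128 / 5 * d * ((ℓ : ℝ) + 1) ^ 3 * α₂ ^ 3) * (((geomT D).len (blkV1 hN D b) * |cf|⁻¹) ^ 3)⁻¹) := by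
        ring
    _ = _ := by rw [hcf2, one_mul]

/-- **PRINT'S (1.55) VERBATIM** follows (p. 86: *"|J|₍₋₃₎ ≦ 2α₀ + 36dα₂|∇^η_{U₀}A|₍₋₂₎ + 50dα₂³ + 10dα₀α₂"*), for EVERY value `X ≥ 0` standing for
`|∇^η_{U₀}A|₍₋₂₎` and every dimensional constant `d_P ≥ d·L³` (the `L³` = the located one-layer-wider reading of «on Ω_j», GAPS G-B8-16, in the global
`blkV1` encoding): `|J(b)| ≤ (2α₀ + 36d_Pα₂X + 50d_Pα₂³ + 10d_Pα₀α₂)(L^{j(b)}η)⁻³` — the size-line hypothesis `h55s`/`hJ` of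
`B8Prop3MultiLevelTorusP26.prop3_multiLevelTorus_V1_P26_vector` with `nJ := α₀ + (128/5)dL³α₂³`. [cite: Balaban1985RegularSpaces, (1.55) p.86] -/
theorem ineq155_abelian_kLevel_printed {Mh k R : ℕ} {P' : Fin (d + 1) → ℕ} (hN : ∀ μ, N0 ℓ Mh k P' μ = (PV d ℓ m K hd hL).sitesPerDir 0)
    (D : TDomains d ℓ Mh k P' R) (hR : 1 ≤ R) (hMh : 1 ≤ Mh) {cf α₀ α₂ dP X : ℝ} (hcf : cf ≠ 0) (hα₀ : 0 ≤ α₀) (hα₂ : 0 ≤ α₂)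
    (hsmall : 4 * ((ℓ : ℝ) + 1) * α₂ ≤ 1) (hdP : (d : ℝ) * ((ℓ : ℝ) + 1) ^ 3 ≤ dP) (hX : 0 ≤ X) (A : BondSpace (PV d ℓ m K hd hL))
    (h40 : ∀ b, ‖covDivPlaq adU1 |cf| (expCfg |cf|⁻¹ (WithLp.ofLp A)) (fun p => entryU1 (plaqHol (expCfg |cf|⁻¹ (WithLp.ofLp A)) p)) b‖
        ≤ α₀ * (((geomT D).len (blkV1 hN D b)) ^ 2)⁻¹ * ((geomT D).len (blkV1 hN D b) * |cf|⁻¹)⁻¹)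
    (h41 : ∀ b, |A b| ≤ α₂ * ((geomT D).len (blkV1 hN D b) * |cf|⁻¹)⁻¹) (b : PBond (PV d ℓ m K hd hL) 0) :
    |dcsE cf (dcE cf A) b|
      ≤ (2 * α₀ + 36 * dP * α₂ * X + 50 * dP * α₂ ^ 3 + 10 * dP * α₀ * α₂) * (((geomT D).len (blkV1 hN D b) * |cf|⁻¹) ^ 3)⁻¹ := by
  have hln : 0 ≤ (((geomT D).len (blkV1 hN D b) * |cf|⁻¹) ^ 3)⁻¹ := by
    rw [len_blkV1]; positivity
  refine (ineq155_abelian_kLevel hN D hR hMh hcf hα₂ hsmall A h40 h41 b).trans (mul_le_mul_of_nonneg_right ?_ hln)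
  have hd0 : (0 : ℝ) ≤ d := Nat.cast_nonneg d
  have hdP0 : 0 ≤ dP := le_trans (by positivity) hdP
  nlinarith [mul_nonneg hdP0 (mul_nonneg hα₂ hX), mul_nonneg hdP0 (mul_nonneg hα₀ hα₂), pow_nonneg hα₂ 3,
    mul_le_mul_of_nonneg_right hdP (pow_nonneg hα₂ 3)]

/-- **FROM THE TYPED CLASS `𝔄_k`** (p40's `B8Eq17ClassAkV1.BondClause19` = (1.9) VERBATIM, thresholds `α₀L^{−2l}(L^lη)⁻¹` for `b ∈ Ω_l`, `l ≤ k`):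
with the bond sets `Ω_l := {b : l ≤ j(b)}` of the `blkV1` encoding («b ∈ Ω_l» read on the initial point), the class hypothesis for `U₁ = e^{iηA}`
gives the pointwise (1.9) input `h40` of the theorems above (take `l := j(b) ≤ k`). [cite: Balaban1985RegularSpaces, (1.9) p.77, (1.40) p.83] -/
theorem h40_of_bondClause19 {Mh k R : ℕ} {P' : Fin (d + 1) → ℕ} (hN : ∀ μ, N0 ℓ Mh k P' μ = (PV d ℓ m K hd hL).sitesPerDir 0)
    (D : TDomains d ℓ Mh k P' R) {η α₀ : ℝ} (A : BondSpace (PV d ℓ m K hd hL))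
    (h19 : B8Eq17ClassAkV1.BondClause19 adU1 entryU1
      (fun l => {b : PBond (PV d ℓ m K hd hL) 0 | l ≤ D.lev (toBox hN b.src : Fin (d + 1) → ℤ)}) k η (ℓ + 1) α₀
      (expCfg η (WithLp.ofLp A))) (b : PBond (PV d ℓ m K hd hL) 0) :
    ‖covDivPlaq adU1 η⁻¹ (expCfg η (WithLp.ofLp A)) (fun p => entryU1 (plaqHol (expCfg η (WithLp.ofLp A)) p)) b‖
      ≤ α₀ * (((geomT D).len (blkV1 hN D b)) ^ 2)⁻¹ * ((geomT D).len (blkV1 hN D b) * η)⁻¹ := by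
  have hmem : b ∈ {b' : PBond (PV d ℓ m K hd hL) 0 | D.lev (toBox hN b.src : Fin (d + 1) → ℤ) ≤ D.lev (toBox hN b'.src : Fin (d + 1) → ℤ)} :=
    Set.mem_setOf_eq ▸ le_rfl
  have h := h19 (D.lev (toBox hN b.src : Fin (d + 1) → ℤ)) (D.lev_le _) b hmem
  rw [len_blkV1]
  push_cast at h
  exact h.le

end KLevel

end

end Literature.MathematicalPhysics.QuantumFieldTheory.Balaban1983to89.B8Eq155AbelianMultiLevelTorus
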